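import Summits.ResolutionOfSingularities.ResolutionOfSingularities.Theorems.MarkedTransferCampaignW46LargeCharRegime
import Summits.ResolutionOfSingularities.ResolutionOfSingularities.Theorems.MarkedTransferCampaignW46TamePolar
import HarnessLib

/-!
# [OURS · L1 W4.6, rung (iv) «large characteristic»] The honest regime (iv) of the TYPED procedure is
# `Regime.charGT n (fun _ b ↦ b)` — «`p > b`» — and in it, at every point of every state, Hironaka's `τ` and the
# directrix of the initial forms of order `b` are computed by first-order polars
# (cell res-hironaka, LADDER-RESOLUTION rung L, D-0089; slot W4.6, seat res-L1-s46-pv-7; host route MarkedTransfer,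
# `--supports stmt-ResolutionOfSingularities-16155 --as helper`)

HONEST FRAMING. Nothing here is a statement of H. Hironaka's manuscript (2017-03-23, [Hironaka2017]) and nothing here
asserts that any statement of it holds. OURS corollaries, over the shared typed-procedure module
`MarkedTransferCampaignW46TypedProcedure` (res-L1-type-o1: `CampaignW46.Regime.charGT`, `AmbientDatum`, `IdealExponent`;
the manuscript enters only through these typed CANDIDATE carriers, used as definitions) and the TREE's directrix
vocabulary (`Literature.AlgebraicGeometry.Resolution.initialForms c J μ` = `cl_μ(J)`, `hironakaTauAt`, `invarianceSpace`),
of this seat's `TamePolar` (p481074: in tame degrees Hironaka's invariance space is the polar kernel). No premise of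
the manuscript, no FACT-LIST premise. AI review is weaker than expert review. No `sorry`, no new definition; axioms
standard.

## What this file pins (DESIGN POINT (REG) (iv) of the shared module: «`Regime.charGT n f` with `f` EXPLICIT … plan-1
## fixes `f`; first candidate `f n b = 2 * n` for p ≥ dim/2 + 1-type bounds»)

The seat's kernel evidence (p477862 tame directrix, p481074 `TamePolar`, `TameRidge`) says that for the TANGENT-CONE
steps of the procedure (directrix, `τ`, ridge) the honest threshold is the ORDER `b` of the ideal exponent, not the
dimension: `f n b = b`, i.e. the regime `E.b < p` (`charGT_order_iff`). In that regime this file proves, for every state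
`(A, E)`, every point `ξ` of `Z` whose local ring has characteristic `p` (the typed rows' standing binder
`CharP (𝒪_{Z,ξ}) p`) and every system `c` of elements of `𝒪_{Z,ξ}` (coordinates of the tangent space):

* `invarianceSpace_initialForms_stalk_eq_iInf_ker_polar` — Hironaka's invariance space of the degree-`b` initial forms
  `cl_b(J_ξ)` (`J_ξ = stalkIdeal E.J ξ`) is the joint kernel of their polar maps `w ↦ Σ_i w_i ∂G/∂Y_i`;
* `hironakaTauAt_stalk_add_finrank_iInf_ker_polar` — hence `τ_ξ = d − dim ⋂_G ker(polar of G)`: the directrix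
  invariant of the state at order `b` is computed by FIRST-ORDER differential calculus, as in characteristic zero.

Both are the ring-level statements `invarianceSpace_initialForms_eq_iInf_ker_polar(_of_lt_char)` /
`hironakaTauAt_add_finrank_iInf_ker_polar` (any local ring whose residue field has `1, …, μ` non-zero, e.g. of
characteristic `p > μ`) read at the stalk. The dimension-type threshold `fun n _ ↦ 2 * n` (CJS Thm. 3.14,
`p ≥ dim X/2 + 1`) governs a DIFFERENT step (near points at imperfect residue fields; barrier
`DirectrixSmallCharacteristic`, empty over perfect fields) and is neither implied by nor implies `fun _ b ↦ b`
(`charGT_order_not_le_dim`, `charGT_dim_not_le_order`: explicit states of the two regimes are not needed — the two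
threshold functions are incomparable as functions, which is what `Regime.charGT_of_le` (p471737) consumes).

## References (context; nothing is cited as a premise)

* `Theorems/MarkedTransferCampaignW46TypedProcedure.lean` (DESIGN POINT (REG) (iv)); this seat's p471737
  (`Regime.charGT_of_le`), p477862, p481074; tree `HironakaDirectrix.lean` (`initialForms`, `hironakaTauAt`).
* Cossart–Piltant 2008, proof of Prop. 4.2 (`τ(x)`, `cl_μ J_x`). [cite: CossartPiltant2008, proof of Prop. 4.2]
* Berthomieu–Hivert–Mourtada 2010, Algorithm 3.5 (directrix by derivatives in characteristic `0`).
  [cite: BerthomieuHivertMourtada2010, Algorithm 3.5]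
-/

noncomputable section

set_option linter.dupNamespace false -- mandated namespace of this single-conjunct summit

open CategoryTheory AlgebraicGeometry TopologicalSpace IsLocalRing

namespace Summit.ResolutionOfSingularities.ResolutionOfSingularities.Theorems
namespace CampaignW46
namespace TameRegime

open MvPolynomial
open Literature.AlgebraicGeometry.Resolution
open Literature.AlgebraicGeometry.Hironaka2017.S02Preliminaries
open Literature.AlgebraicGeometry.Hironaka2017.Datum

universe u

/-! ## Ring level: initial forms of an ideal of a local ring with tame residue characteristic -/

section LocalRing

variable {R : Type u} [CommRing R] [IsLocalRing R] {d : ℕ} (c : Fin d → R)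

/-- The residue field of a local ring of prime characteristic `p` has characteristic `p`. [folklore] -/
theorem charP_residueField (p : ℕ) [Fact p.Prime] [CharP R p] : CharP (ResidueField R) p :=
  (CharP.charP_iff_prime_eq_zero (Fact.out : p.Prime)).mpr (by
    rw [← map_natCast (residue R), CharP.cast_eq_zero, map_zero])

/-- [OURS · L1 W4.6 (iv); NOT a statement of the manuscript] **Initial forms of tame order: the invariance space is
the joint polar kernel.** For an ideal `J` of a local ring `R`, elements `c_1, …, c_d` of `R` and an order `μ` with
`1, …, μ` non-zero in the residue field, Hironaka's invariance space of `cl_μ(J)` is `⋂_{G ∈ cl_μ(J)} ker (w ↦ ∂_w G)`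
(`TamePolar.invarianceSpace_eq_iInf_ker_polar`; the members of `cl_μ(J)` are forms of degree `μ`). [folklore] -/
theorem invarianceSpace_initialForms_eq_iInf_ker_polar (J : Ideal R) {μ : ℕ}
    (hchar : ∀ m : ℕ, 1 ≤ m → m ≤ μ → (m : ResidueField R) ≠ 0) :
    invarianceSpace (ResidueField R) (initialForms c J μ : Set (MvPolynomial (Fin d) (ResidueField R))) =
      ⨅ G ∈ (initialForms c J μ : Set (MvPolynomial (Fin d) (ResidueField R))),
        LinearMap.ker (Fintype.linearCombination (ResidueField R) fun i : Fin d => pderiv i G) :=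
  TamePolar.invarianceSpace_eq_iInf_ker_polar (ResidueField R) _ fun _ hG m h1 hm =>
    hchar m h1 (hm.trans (isHomogeneous_of_mem_initialForms c hG).totalDegree_le)

/-- [OURS · L1 W4.6 (iv)] The same in residue characteristic `p > μ` (the local ring itself of characteristic `p`, as
for the stalks of a scheme over a field of characteristic `p`). [folklore] -/
theorem invarianceSpace_initialForms_eq_iInf_ker_polar_of_lt_char (p : ℕ) [Fact p.Prime] [CharP R p] (J : Ideal R)
    {μ : ℕ} (hμ : μ < p) :
    invarianceSpace (ResidueField R) (initialForms c J μ : Set (MvPolynomial (Fin d) (ResidueField R))) =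
      ⨅ G ∈ (initialForms c J μ : Set (MvPolynomial (Fin d) (ResidueField R))),
        LinearMap.ker (Fintype.linearCombination (ResidueField R) fun i : Fin d => pderiv i G) :=
  haveI := charP_residueField (R := R) p
  invarianceSpace_initialForms_eq_iInf_ker_polar c J (TamePolar.natCast_ne_zero_of_lt_char p hμ)

/-- [OURS · L1 W4.6 (iv); NOT a statement of the manuscript] **`τ` at tame order is first-order**:
`τ_μ(J) + dim ⋂_{G ∈ cl_μ(J)} ker (w ↦ ∂_w G) = d` — Hironaka's `τ` of `J` at order `μ` (tree `hironakaTauAt`, the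
dimension of the directrix of `cl_μ(J)`) is computed by the polars of the initial forms whenever `1, …, μ` are non-zero
in the residue field. [folklore] -/
theorem hironakaTauAt_add_finrank_iInf_ker_polar (J : Ideal R) {μ : ℕ}
    (hchar : ∀ m : ℕ, 1 ≤ m → m ≤ μ → (m : ResidueField R) ≠ 0) :
    hironakaTauAt c J μ +
      Module.finrank (ResidueField R)
        (⨅ G ∈ (initialForms c J μ : Set (MvPolynomial (Fin d) (ResidueField R))),
          LinearMap.ker (Fintype.linearCombination (ResidueField R) fun i : Fin d => pderiv i G) :
            Submodule (ResidueField R) (Fin d → ResidueField R)) = d := by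
  rw [← invarianceSpace_initialForms_eq_iInf_ker_polar c J hchar]
  exact hironakaTau_add_finrank_invarianceSpace (ResidueField R) _

/-- [OURS · L1 W4.6 (iv)] The same in residue characteristic `p > μ`. [folklore] -/
theorem hironakaTauAt_add_finrank_iInf_ker_polar_of_lt_char (p : ℕ) [Fact p.Prime] [CharP R p] (J : Ideal R)
    {μ : ℕ} (hμ : μ < p) :
    hironakaTauAt c J μ +
      Module.finrank (ResidueField R)
        (⨅ G ∈ (initialForms c J μ : Set (MvPolynomial (Fin d) (ResidueField R))),
          LinearMap.ker (Fintype.linearCombination (ResidueField R) fun i : Fin d => pderiv i G) :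
            Submodule (ResidueField R) (Fin d → ResidueField R)) = d :=
  haveI := charP_residueField (R := R) p
  hironakaTauAt_add_finrank_iInf_ker_polar c J (TamePolar.natCast_ne_zero_of_lt_char p hμ)

end LocalRing

/-! ## Typed level: regime (iv) of the shared module with the honest threshold `f n b = b` -/

section Typed

variable {n : ℕ} {p : ℕ} [Fact p.Prime] {K : Type u} [Field K] [CharP K p]

/-- [OURS · L1 W4.6 (iv)] The regime «`p > b`»: `Regime.charGT n (fun _ b ↦ b)` holds at the state `(A, E)` iff the
order `b` of the ideal exponent `E = (J, b)` is `< p` (unfolding of the shared module's `Regime.charGT`). [folklore] -/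
theorem charGT_order_iff (A : AmbientDatum p K) (E : IdealExponent A.Z) :
    Regime.charGT (p := p) (K := K) n (fun _ b => b) A E ↔ E.b < p :=
  Iff.rfl

/-- [OURS · L1 W4.6 (iv)] The order threshold and the dimension-type threshold are incomparable as threshold functions
(so neither regime contains the other via `Regime.charGT_of_le`, p471737): `¬ (fun _ b ↦ b) ≤ (fun n _ ↦ 2 * n)`.
[folklore] -/
theorem charGT_order_not_le_dim : ¬ ((fun _ b : ℕ => b) ≤ fun n _ : ℕ => 2 * n) := by
  intro h
  have := h 0 1
  simp at this

/-- [OURS · L1 W4.6 (iv)] … and `¬ (fun n _ ↦ 2 * n) ≤ (fun _ b ↦ b)`. [folklore] -/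
theorem charGT_dim_not_le_order : ¬ ((fun n _ : ℕ => 2 * n) ≤ fun _ b : ℕ => b) := by
  intro h
  have := h 1 0
  simp at this

/-- [OURS · L1 W4.6 (iv); NOT a statement of the manuscript] **Regime (iv) makes the directrix first-order at every
point of every state.** For a state `(A, E)` of the typed procedure in `Regime.charGT n (fun _ b ↦ b)` (`E.b < p`), a
point `ξ` of `Z` whose local ring has characteristic `p` (the typed rows' standing binder) and elements
`c_1, …, c_d ∈ 𝒪_{Z,ξ}`: the invariance space of the order-`b` initial forms `cl_b(J_ξ)` of the stalk ideal
`J_ξ = stalkIdeal E.J ξ` is the joint polar kernel. [folklore] -/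
theorem invarianceSpace_initialForms_stalk_eq_iInf_ker_polar (A : AmbientDatum p K) (E : IdealExponent A.Z)
    (hE : Regime.charGT (p := p) (K := K) n (fun _ b => b) A E) (ξ : A.Z) (hp : CharP (A.Z.presheaf.stalk ξ) p)
    {d : ℕ} (c : Fin d → A.Z.presheaf.stalk ξ) :
    invarianceSpace (ResidueField (A.Z.presheaf.stalk ξ))
        (initialForms c (stalkIdeal E.J ξ) E.b :
          Set (MvPolynomial (Fin d) (ResidueField (A.Z.presheaf.stalk ξ)))) =
      ⨅ G ∈ (initialForms c (stalkIdeal E.J ξ) E.b :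
          Set (MvPolynomial (Fin d) (ResidueField (A.Z.presheaf.stalk ξ)))),
        LinearMap.ker (Fintype.linearCombination (ResidueField (A.Z.presheaf.stalk ξ))
          fun i : Fin d => pderiv i G) :=
  haveI := hp
  invarianceSpace_initialForms_eq_iInf_ker_polar_of_lt_char c p (stalkIdeal E.J ξ) hE

/-- [OURS · L1 W4.6 (iv); NOT a statement of the manuscript] **Regime (iv) makes `τ` first-order at every point of
every state**: with the same data, `τ_ξ(J_ξ, b) + dim ⋂_{G ∈ cl_b(J_ξ)} ker(polar of G) = d`. [folklore] -/
theorem hironakaTauAt_stalk_add_finrank_iInf_ker_polar (A : AmbientDatum p K) (E : IdealExponent A.Z)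
    (hE : Regime.charGT (p := p) (K := K) n (fun _ b => b) A E) (ξ : A.Z) (hp : CharP (A.Z.presheaf.stalk ξ) p)
    {d : ℕ} (c : Fin d → A.Z.presheaf.stalk ξ) :
    hironakaTauAt c (stalkIdeal E.J ξ) E.b +
      Module.finrank (ResidueField (A.Z.presheaf.stalk ξ))
        (⨅ G ∈ (initialForms c (stalkIdeal E.J ξ) E.b :
            Set (MvPolynomial (Fin d) (ResidueField (A.Z.presheaf.stalk ξ)))),
          LinearMap.ker (Fintype.linearCombination (ResidueField (A.Z.presheaf.stalk ξ))
            fun i : Fin d => pderiv i G) :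
              Submodule (ResidueField (A.Z.presheaf.stalk ξ)) (Fin d → ResidueField (A.Z.presheaf.stalk ξ))) = d :=
  haveI := hp
  hironakaTauAt_add_finrank_iInf_ker_polar_of_lt_char c p (stalkIdeal E.J ξ) hE

/-- [OURS · L1 W4.6 (iv)] Monotonicity in the threshold (from p471737 `Regime.charGT_of_le`): any regime
`Regime.charGT n f` with `(fun _ b ↦ b) ≤ f` (a threshold at least the order, e.g. V5's `fun _ b ↦ b !` for the
next level) lies inside regime (iv), so the two statements above hold there as well. [folklore] -/
theorem invarianceSpace_initialForms_stalk_of_le {f : ℕ → ℕ → ℕ} (hf : (fun _ b : ℕ => b) ≤ f)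
    (A : AmbientDatum p K) (E : IdealExponent A.Z) (hE : Regime.charGT (p := p) (K := K) n f A E) (ξ : A.Z)
    (hp : CharP (A.Z.presheaf.stalk ξ) p) {d : ℕ} (c : Fin d → A.Z.presheaf.stalk ξ) :
    invarianceSpace (ResidueField (A.Z.presheaf.stalk ξ))
        (initialForms c (stalkIdeal E.J ξ) E.b :
          Set (MvPolynomial (Fin d) (ResidueField (A.Z.presheaf.stalk ξ)))) =
      ⨅ G ∈ (initialForms c (stalkIdeal E.J ξ) E.b :
          Set (MvPolynomial (Fin d) (ResidueField (A.Z.presheaf.stalk ξ)))),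
        LinearMap.ker (Fintype.linearCombination (ResidueField (A.Z.presheaf.stalk ξ))
          fun i : Fin d => pderiv i G) :=
  invarianceSpace_initialForms_stalk_eq_iInf_ker_polar A E (Regime.charGT_of_le (fun b => hf n b) A E hE) ξ hp c

/-- [OURS · L1 W4.6 (iv)] The factorial threshold of the prior's V5 («wild data reappear at level 1 via `b!`») is at
least the order threshold: `(fun _ b ↦ b) ≤ (fun _ b ↦ b !)`, so `Regime.charGT n (fun _ b ↦ b !)` is a sub-regime of
regime (iv). [folklore] -/
theorem order_le_factorial : (fun _ b : ℕ => b) ≤ fun _ b : ℕ => b.factorial :=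
  fun _ b => Nat.self_le_factorial b

end Typed

end TameRegime
end CampaignW46
end Summit.ResolutionOfSingularities.ResolutionOfSingularities.Theorems

end
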